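import Mathlib
import HarnessLib
import Literature.AlgebraicGeometry.Ramification.InertiaNormalSylow
import Literature.AlgebraicGeometry.Resolution.ResolutionOfSingularities
import Summits.ResolutionOfSingularities.ResolutionOfSingularities.Theorems.WildQuotientsWildQuotientResolutionTameCoresPhaseZero
import Summits.ResolutionOfSingularities.ResolutionOfSingularities.Theorems.WildQuotientsWildQuotientResolutionStandardFormKernel

/-!
# Phase 0 along a list of tame cores under the JOINT-KERNEL group condition (all dimensions)
# (crux `WildQuotients.WildQuotientResolution`, stub `stub_phaseZeroHighDim`)

Crux stmt-ResolutionOfSingularities-15640 (`WildQuotientResolution`), registered stub `stub_phaseZeroHighDim`.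
✓`phaseZero_of_tameCores` (p822635) runs the engine ✓`standardise_tameCores` (one tame move per normal core
`M ∈ Ms`) and concludes by the standard-form criterion, so it must ask: every tame `h ≠ 1` of every non-p-closed
subgroup has a core below it. With the joint kernel of ✓`StandardFormKernel` (p823531) the SAME engine proves
Phase 0 under the weaker, purely group-theoretic

**Condition (K)** (`hcore`). For all subgroups `U ≤ H ≤ G` with `U` normal in `H`, `H/U` abelian without
`p`-torsion (`[H,H] ≤ U`, `U` closed under `p`-th roots in `H`) and NO element `u ∈ U` of order prime to `p`
with a core `M ≤ ⟨u⟩`, the group `H` has a normal Sylow `p`-subgroup.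

**Theorem** (`phaseZero_of_tameCores_kernel`). Crux datum, `Ms` a list of non-trivial normal subgroups of order
prime to `p`, Condition (K) ⟹ the conclusion of `stub_phaseZeroHighDim`, in every dimension.

Corollaries: `phaseZero_of_tameCores_commutator` — it suffices that every non-p-closed `H ≤ G` have a core
`M ≤ ⟨u⟩` for some `u ∈ [H, H]` of order prime to `p` (e.g. `M = ⟨u⟩` cyclic normal inside every such
`[H, H]`); `hcoreK_of_hcore` — p822635's hypothesis implies (K), so this file subsumes it. NEW CLASS: the wreath
products `C_ℓ ≀ C_2 = C_ℓ² ⋊ C_2` in characteristic `2` (`ℓ` odd prime) acting with a fixed point: p822635 does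
not apply (the factor `C_ℓ × 1` of a non-2-closed group contains no normal subgroup, and its inert locus meets
that of its conjugate `1 × C_ℓ` on every model — tame abelian fixed points persist), ✓`phaseZero_of_primeOrbitSeparation`
(p822966) is VACUOUS there for the same reason, but the anti-diagonal `A = {(a, a⁻¹)}` is a normal core lying in
`[H, H]` of both non-2-closed subgroups `H ∈ {G, A ⋊ C_2 ≅ S_3}`: ONE tame move at `Z_A` gives Phase 0.

[OURS · crux stmt-ResolutionOfSingularities-15640 · helper toward `stub_phaseZeroHighDim` (an all-dimensional
SLICE of the stub strictly containing p822635; NOT a proof of the stub); counted 0; AI-level work, weaker than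
expert review.] [folklore]
-/

-- single-problem summit: the doubled namespace component `ResolutionOfSingularities` is forced
set_option linter.dupNamespace false

noncomputable section

open CategoryTheory AlgebraicGeometry TopologicalSpace IsLocalRing
open Literature.AlgebraicGeometry.Resolution Literature.AlgebraicGeometry.Ramification
open Scheme.IdealSheafData
open Summit.ResolutionOfSingularities.ResolutionOfSingularities.Theorems.WildQuotientResolution.PointBlowupStalkData
open Summit.ResolutionOfSingularities.ResolutionOfSingularities.Theorems.WildQuotientResolution.InertLocusStalk

namespace Summit.ResolutionOfSingularities.ResolutionOfSingularities.Theorems.WildQuotientResolution.StandardForm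

/-! ## Group theory: Condition (K) and its sources -/

section Group

variable {G : Type} [Group G] (p : ℕ) (Ms : List (Subgroup G))

/-- **Condition (K)** for `(G, Ms, p)`, spelled out as a hypothesis shape (not a definition): every `H ≤ G` with a
normal `U ≤ H`, `H/U` abelian and `p`-torsion-free, `U` free of cored elements of order prime to `p`, is p-closed.
This lemma: Condition (K) follows from p822635's hypothesis «every tame `h ≠ 1` of every non-p-closed subgroup has a
core below it» (then such a `U` is a normal `p`-subgroup of index prime to `p`). [folklore] -/
theorem hcoreK_of_hcore [Fact p.Prime] [Finite G]
    (hcore : ∀ H : Subgroup G, ¬ HasNormalSylow p H → ∀ h ∈ H, h ≠ 1 → (orderOf h).Coprime p →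
      ∃ M ∈ Ms, M ≤ Subgroup.zpowers h) :
    ∀ H U : Subgroup G, U ≤ H → (∀ h ∈ H, ∀ u ∈ U, h * u * h⁻¹ ∈ U) →
      (∀ a ∈ H, ∀ b ∈ H, a * b * a⁻¹ * b⁻¹ ∈ U) → (∀ g ∈ H, g ^ p ∈ U → g ∈ U) →
      (∀ u ∈ U, (orderOf u).Coprime p → ∀ M ∈ Ms, ¬ M ≤ Subgroup.zpowers u) → HasNormalSylow p H := by
  intro H U hUH hUn _ hroot hU
  by_contra hH
  have htame := hcore H hH
  -- `U` has no non-trivial element of order prime to `p`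
  have hU1 : ∀ u ∈ U, (orderOf u).Coprime p → u = 1 := by
    intro u hu hcop
    by_contra hne
    obtain ⟨M, hM, hMu⟩ := htame u (hUH hu) hne hcop
    exact hU u hu hcop M hM hMu
  -- the normal `p`-subgroup `U ∩ H` of `H`
  let V : Subgroup H := U.subgroupOf H
  haveI hVn : V.Normal := by
    refine ⟨fun v hv h => ?_⟩
    exact hUn h h.2 v (Subgroup.mem_subgroupOf.mp hv)
  have hVp : IsPGroup p V := by
    apply isPGroup_of_forall_coprime_eq_one (p := p)
    rintro ⟨⟨v, hvH⟩, hvU⟩ hcop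
    rw [Subgroup.orderOf_mk, Subgroup.orderOf_mk] at hcop
    exact Subtype.ext (Subtype.ext (hU1 v (Subgroup.mem_subgroupOf.mp hvU) hcop))
  refine hH (HasNormalSylow.of_normal_of_not_dvd_index V hVp fun hdvd => ?_)
  rw [Subgroup.index_eq_card] at hdvd
  obtain ⟨q, hq⟩ := exists_prime_orderOf_dvd_card' (G := H ⧸ V) p hdvd
  obtain ⟨g, rfl⟩ := QuotientGroup.mk_surjective q
  have hgp : (g : G) ^ p ∈ U := by
    have h1 : (QuotientGroup.mk (s := V) g) ^ p = 1 := by rw [← hq, pow_orderOf_eq_one]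
    rw [← QuotientGroup.mk_pow, QuotientGroup.eq_one_iff] at h1
    simpa [V, Subgroup.mem_subgroupOf] using h1
  have hg1 : QuotientGroup.mk (s := V) g = 1 := by
    rw [QuotientGroup.eq_one_iff]
    exact Subgroup.mem_subgroupOf.mpr (hroot g g.2 hgp)
  rw [hg1, orderOf_one] at hq
  exact (Fact.out : p.Prime).one_lt.ne hq

/-- **Commutator source of Condition (K)**: if every non-p-closed `H ≤ G` has a core `M ≤ ⟨u⟩` for some `u ∈ [H, H]`
of order prime to `p`, Condition (K) holds (`[H, H] ≤ U`). [folklore] -/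
theorem hcoreK_of_commutator
    (hA : ∀ H : Subgroup G, ¬ HasNormalSylow p H →
      ∃ M ∈ Ms, ∃ u ∈ ⁅H, H⁆, (orderOf u).Coprime p ∧ M ≤ Subgroup.zpowers u) :
    ∀ H U : Subgroup G, U ≤ H → (∀ h ∈ H, ∀ u ∈ U, h * u * h⁻¹ ∈ U) →
      (∀ a ∈ H, ∀ b ∈ H, a * b * a⁻¹ * b⁻¹ ∈ U) → (∀ g ∈ H, g ^ p ∈ U → g ∈ U) →
      (∀ u ∈ U, (orderOf u).Coprime p → ∀ M ∈ Ms, ¬ M ≤ Subgroup.zpowers u) → HasNormalSylow p H := by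
  intro H U _ _ hcomm _ hU
  by_contra hH
  obtain ⟨M, hM, u, hu, hcop, hMu⟩ := hA H hH
  have hle : ⁅H, H⁆ ≤ U :=
    Subgroup.commutator_le.mpr fun a ha b hb => by rw [commutatorElement_def]; exact hcomm a ha b hb
  exact hU u (hle hu) hcop M hM hMu

end Group

/-! ## The joint kernel of the inertia group of a point -/

section Point

variable {X : Scheme.{0}} {G : Type} [Group G] (σ : G →* Aut X) (p : ℕ) [Fact p.Prime]
  (x : X) [CharP (ResidueField (X.presheaf.stalk x)) p]
  (a : inertiaSubgroup σ x → (X.presheaf.stalk x ⟶ X.presheaf.stalk x))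
  (τ : inertiaSubgroup σ x →* (X.presheaf.stalk x ≃+* X.presheaf.stalk x))
  (hkey : ∀ g : inertiaSubgroup σ x, Spec.map (a g) ≫ X.fromSpecStalk x = X.fromSpecStalk x ≫ (σ (g : G)).hom)
  (hτ : ∀ (g : inertiaSubgroup σ x) (r : X.presheaf.stalk x), τ g r = (a g⁻¹).hom r)

include hkey hτ

/-- **The joint kernel of `I_x`** (scheme level). For the stalk action `(a, τ)` of `I_x` and boundary equations
`z : Fin n → 𝔪_x ∖ 𝔪_x²` with stable lines, there is `U ≤ I_x`, normal in `I_x`, containing the commutators of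
`I_x` and closed under `p`-th roots in `I_x`, such that no `u ∈ U` of order prime to `p` has some `zᵢ` in
`𝔞_{τ u} + 𝔪_x²` (✓`exists_jointKernel` through ✓`stalkAction_residueTrivial`, pushed into `G`). [folklore] -/
theorem exists_jointKernel_inertia {n : ℕ} (z : Fin n → X.presheaf.stalk x)
    (hz : ∀ i, z i ∈ maximalIdeal (X.presheaf.stalk x)) (hz2 : ∀ i, z i ∉ maximalIdeal (X.presheaf.stalk x) ^ 2)
    (hstab : ∀ (g : inertiaSubgroup σ x) (i : Fin n),
      τ g (z i) ∈ Ideal.span {z i} ⊔ maximalIdeal (X.presheaf.stalk x) ^ 2) :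
    ∃ U : Subgroup G, U ≤ inertiaSubgroup σ x ∧
      (∀ h ∈ inertiaSubgroup σ x, ∀ u ∈ U, h * u * h⁻¹ ∈ U) ∧
      (∀ a' ∈ inertiaSubgroup σ x, ∀ b ∈ inertiaSubgroup σ x, a' * b * a'⁻¹ * b⁻¹ ∈ U) ∧
      (∀ g ∈ inertiaSubgroup σ x, g ^ p ∈ U → g ∈ U) ∧
      ∀ u : inertiaSubgroup σ x, (u : G) ∈ U → (orderOf (u : G)).Coprime p →
        ∀ i, z i ∉ augIdeal (τ u) ⊔ maximalIdeal (X.presheaf.stalk x) ^ 2 := by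
  have hres : ∀ (g : inertiaSubgroup σ x) (s : X.presheaf.stalk x),
      τ g s - s ∈ maximalIdeal (X.presheaf.stalk x) :=
    stalkAction_residueTrivial σ x a τ hkey hτ le_rfl
  obtain ⟨U₀, hU₀n, hcomm, hroot, hU₀⟩ := exists_jointKernel p τ hres z hz hz2 hstab
  have hmem : ∀ {u : inertiaSubgroup σ x}, (u : G) ∈ U₀.map (inertiaSubgroup σ x).subtype ↔ u ∈ U₀ := by
    intro u
    constructor
    · intro h
      obtain ⟨v, hv, hvu⟩ := Subgroup.mem_map.mp h
      have : v = u := Subtype.ext (by simpa using hvu)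
      exact this ▸ hv
    · intro h
      exact Subgroup.mem_map.mpr ⟨u, h, rfl⟩
  refine ⟨U₀.map (inertiaSubgroup σ x).subtype, fun g hg => ?_, fun h hh u hu => ?_, fun a' ha' b hb => ?_,
    fun g hg hgp => ?_, fun u hu hcop i => ?_⟩
  · obtain ⟨v, -, rfl⟩ := Subgroup.mem_map.mp hg
    exact v.2
  · obtain ⟨v, hv, rfl⟩ := Subgroup.mem_map.mp hu
    have h' : ((⟨h, hh⟩ * v * ⟨h, hh⟩⁻¹ : inertiaSubgroup σ x) : G) = h * (v : G) * h⁻¹ := rfl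
    rw [Subgroup.coe_subtype, ← h']
    exact hmem.mpr (hU₀n.conj_mem v hv ⟨h, hh⟩)
  · have h' : ((⟨a', ha'⟩ * ⟨b, hb⟩ * ⟨a', ha'⟩⁻¹ * ⟨b, hb⟩⁻¹ : inertiaSubgroup σ x) : G) =
        a' * b * a'⁻¹ * b⁻¹ := rfl
    rw [← h']
    exact hmem.mpr (hcomm _ _)
  · have h' : ((⟨g, hg⟩ ^ p : inertiaSubgroup σ x) : G) = g ^ p := rfl
    rw [← h'] at hgp
    exact (hmem (u := ⟨g, hg⟩)).mpr (hroot ⟨g, hg⟩ (hmem.mp hgp))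
  · exact hU₀ u (hmem.mp hu) (by rwa [← Subgroup.orderOf_coe]) i

end Point

/-! ## The theorem -/

/-- **Phase 0 in every dimension along a list of tame cores, under Condition (K)** (crux
stmt-ResolutionOfSingularities-15640, an all-dimensional SLICE of `stub_phaseZeroHighDim` containing p822635). Let
`Ms` be a list of non-trivial normal subgroups of `G` of order prime to `p` such that Condition (K) holds: every
`H ≤ G` with a normal `U ≤ H`, `H/U` abelian and `p`-torsion-free, and no `u ∈ U` of order prime to `p` with a core
`M ≤ ⟨u⟩`, `M ∈ Ms`, is p-closed. Then the conclusion of `stub_phaseZeroHighDim` holds for every crux datum: blow up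
the inert loci of the cores in turn (✓`standardise_tameCores`); at a point `x` of the final model the cored tame
elements of `I_x` have their fixed loci in the strict stable boundary, so (✓`exists_jointKernel_inertia`) the joint
kernel `U` of the line characters contains no cored tame element, and (K) applied to `U ≤ I_x` gives p-closedness.
[folklore] -/
theorem phaseZero_of_tameCores_kernel (p : ℕ) (hp : p.Prime) (k : Type) [Field k] [CharP k p]
    (X' X₁ : Scheme.{0}) (f : X₁ ⟶ Spec (.of k)) (q : X' ⟶ X₁) (G : Type) [Group G] [Finite G]
    (ρ : G →* Aut X') (hfaith : Function.Injective ρ)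
    [IsSeparated f] [LocallyOfFiniteType f] [QuasiCompact f] [IsIntegral X']
    (hreg : Scheme.IsRegular X') [IsFinite q] (hρ : ∀ g : G, (ρ g).hom ≫ q = q)
    (Ms : List (Subgroup G)) (hMs : ∀ M ∈ Ms, M.Normal ∧ M ≠ ⊥ ∧ (Nat.card M).Coprime p)
    (hcore : ∀ H U : Subgroup G, U ≤ H → (∀ h ∈ H, ∀ u ∈ U, h * u * h⁻¹ ∈ U) →
      (∀ a ∈ H, ∀ b ∈ H, a * b * a⁻¹ * b⁻¹ ∈ U) → (∀ g ∈ H, g ^ p ∈ U → g ∈ U) →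
      (∀ u ∈ U, (orderOf u).Coprime p → ∀ M ∈ Ms, ¬ M ≤ Subgroup.zpowers u) → HasNormalSylow p H) :
    ∃ (Xs : Scheme.{0}) (π : Xs ⟶ X') (ρs : G →* Aut Xs), IsProper π ∧ IsBirational π ∧
      IsIntegral Xs ∧ Scheme.IsRegular Xs ∧ (∀ g : G, (ρs g).hom ≫ π = π ≫ (ρ g).hom) ∧
      (∀ x : Xs, HasNormalSylow p (inertiaSubgroup ρs x)) ∧
      ∀ x : Xs, ∃ U : Xs.Opens, IsAffineOpen U ∧ x ∈ U ∧ ∀ g : G, (ρs g).hom ⁻¹ᵁ U = U := by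
  classical
  haveI : Fact p.Prime := ⟨hp⟩
  set s₀ : X' ⟶ Spec (.of k) := q ≫ f with hs₀
  obtain ⟨hρ₀, hcov₀⟩ := iterHypotheses_of_cruxData X' X₁ f q ρ hρ
  haveI : IsLocallyNoetherian X' := LocallyOfFiniteType.isLocallyNoetherian s₀
  obtain ⟨Xs, π, ρs, Es, hπp, hbir, hXs, hXsreg, hequiv, hcov, hEs, hEsinv, hest⟩ :=
    standardise_tameCores p k Ms hMs X' s₀ ρ hfaith hreg hρ₀ hcov₀ [] (hasSNC_nil_of_isRegular hreg)
      (fun D hD => absurd hD (by simp)) [] (fun M hM => absurd hM (by simp))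
  haveI := hπp; haveI := hXs
  have hρs : ∀ g : G, (ρs g).hom ≫ (π ≫ s₀) = π ≫ s₀ := fun g => by
    rw [← Category.assoc, hequiv g, Category.assoc, hρ₀ g]
  have hcharS : ∀ x : Xs, CharP (ResidueField (Xs.presheaf.stalk x)) p := fun x =>
    (((IsLocalRing.residue (Xs.presheaf.stalk x)).comp ((Xs.presheaf.germ ⊤ x trivial).hom.comp
      (((π ≫ s₀).appTop).hom.comp (Scheme.ΓSpecIso (.of k)).inv.hom))).charP_iff_charP p).mp inferInstance
  have hZ' : ∀ K : Subgroup G, IsClosed {x : Xs | K ≤ inertiaSubgroup ρs x} := fun K =>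
    PointMoveNoNpcCurves.isClosed_setOf_le_inertia (π ≫ s₀) ρs hρs K
  have hEstab : ∀ D ∈ Es, ∀ g : G, (ρs g).hom.base ⁻¹' (D.support : Set Xs) = D.support :=
    fun D hD g => preimage_support_of_comap_eq ρs g (hEsinv D hD g)
  refine ⟨Xs, π, ρs, hπp, hbir, hXs, hXsreg, hequiv, fun x => ?_, hcov⟩
  haveI := hcharS x
  haveI := hXsreg x
  -- boundary members through `x`
  let T := {D' : Xs.IdealSheafData // D' ∈ Es ∧ x ∈ D'.support}
  haveI hTfin : Finite T :=
    (((List.finite_toSet Es).subset (fun D' (h : D' ∈ Es ∧ x ∈ D'.support) => h.1)).to_subtype :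
      Finite {D' : Xs.IdealSheafData | D' ∈ Es ∧ x ∈ D'.support})
  haveI : Fintype T := Fintype.ofFinite T
  let n := Fintype.card T
  let e : T ≃ Fin n := Fintype.equivFin T
  obtain ⟨hregx, u, hu, ⟨ι, hιinj, hι⟩, -⟩ := hEs x
  have hrsop : IsRsopPart (u ∘ id) := isRsopPart_comp_of_rsop rfl u hu id Function.injective_id
  let z : Fin n → Xs.presheaf.stalk x := fun i => u (ι (e.symm i))
  have hzT : ∀ D' : T, z (e D') = u (ι D') := fun D' => by simp only [z, Equiv.symm_apply_apply]
  have hvs : ∀ D' : T, stalkIdeal (vanishingIdeal D'.1.support) x = Ideal.span {u (ι D')} := fun D' => by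
    rw [hEs.vanishingIdeal_support D'.2.1, hι D']
  -- the stalk action of `I_x` and the stable lines
  obtain ⟨a, τ, hkey, hτ⟩ := exists_stalkAction ρs x (inertiaSubgroup ρs x)
    (fun g hg => apply_eq_of_mem_inertiaSubgroup ρs hg)
  have hz : ∀ i, z i ∈ maximalIdeal (Xs.presheaf.stalk x) := fun i => hu ▸ Ideal.subset_span ⟨_, rfl⟩
  have hz2 : ∀ i, z i ∉ maximalIdeal (Xs.presheaf.stalk x) ^ 2 := fun i => hrsop.not_mem_sq _
  have hstab : ∀ (g : inertiaSubgroup ρs x) (i : Fin n),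
      τ g (z i) ∈ Ideal.span {z i} ⊔ maximalIdeal (Xs.presheaf.stalk x) ^ 2 := fun g i =>
    apply_mem_span_of_stalkIdeal_eq_span ρs x a τ hkey hτ (e.symm i).1.support
      (fun g => hEstab _ (e.symm i).2.1 (g : G)) (hvs (e.symm i)) g
  -- the joint kernel, and Condition (K)
  obtain ⟨U, hUle, hUn, hcomm, hroot, hU⟩ := exists_jointKernel_inertia ρs p x a τ hkey hτ z hz hz2 hstab
  refine hcore _ U hUle hUn hcomm hroot fun w hw hcop M hM hMw => ?_
  -- a cored tame `w ∈ U`: its inert locus lies in the boundary, hence some `zᵢ ∈ 𝔞_{τ w} + 𝔪²` — contradiction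
  let g : inertiaSubgroup ρs x := ⟨w, hUle hw⟩
  have hg : (orderOf g).Coprime p := by rwa [Subgroup.orderOf_mk]
  have hsub : {y : Xs | Subgroup.zpowers (g : G) ≤ inertiaSubgroup ρs y} ⊆ ⋃ D ∈ Es, (D.support : Set Xs) :=
    hest M (by simpa using hM) (g : G) hcop hMw
  obtain ⟨D, hD, hxD, hle⟩ :=
    exists_mem_stalkIdeal_le_augIdeal_of_subset_iUnion ρs p x a τ hkey hτ g hg g.2 (hZ' _) Es hsub
  refine hU g hw hcop (e ⟨D, hD, hxD⟩) ?_
  rw [hzT]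
  exact Ideal.mem_sup_left (hle ((hvs ⟨D, hD, hxD⟩) ▸ Ideal.mem_span_singleton_self _))

/-- **Commutator form** (crux stmt-ResolutionOfSingularities-15640). If every non-p-closed subgroup `H ≤ G` has a
core `M ∈ Ms` below some element `u ∈ [H, H]` of order prime to `p` (e.g. `M = ⟨u⟩`), then the conclusion of
`stub_phaseZeroHighDim` holds for every crux datum, in every dimension. Covers `C_ℓ ≀ C_2` in characteristic `2`
with the single core `A = {(a, a⁻¹)}` (see the module docstring), every `S_3`/`D_ℓ` in characteristic `2`,
`C_ℓ ⋊ C_p`, `SL₂(𝔽₃)` in characteristic `3` (core `{±1} ≤ Q_8 = [H,H]`), … [folklore] -/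
theorem phaseZero_of_tameCores_commutator (p : ℕ) (hp : p.Prime) (k : Type) [Field k] [CharP k p]
    (X' X₁ : Scheme.{0}) (f : X₁ ⟶ Spec (.of k)) (q : X' ⟶ X₁) (G : Type) [Group G] [Finite G]
    (ρ : G →* Aut X') (hfaith : Function.Injective ρ)
    [IsSeparated f] [LocallyOfFiniteType f] [QuasiCompact f] [IsIntegral X']
    (hreg : Scheme.IsRegular X') [IsFinite q] (hρ : ∀ g : G, (ρ g).hom ≫ q = q)
    (Ms : List (Subgroup G)) (hMs : ∀ M ∈ Ms, M.Normal ∧ M ≠ ⊥ ∧ (Nat.card M).Coprime p)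
    (hA : ∀ H : Subgroup G, ¬ HasNormalSylow p H →
      ∃ M ∈ Ms, ∃ u ∈ ⁅H, H⁆, (orderOf u).Coprime p ∧ M ≤ Subgroup.zpowers u) :
    ∃ (Xs : Scheme.{0}) (π : Xs ⟶ X') (ρs : G →* Aut Xs), IsProper π ∧ IsBirational π ∧
      IsIntegral Xs ∧ Scheme.IsRegular Xs ∧ (∀ g : G, (ρs g).hom ≫ π = π ≫ (ρ g).hom) ∧
      (∀ x : Xs, HasNormalSylow p (inertiaSubgroup ρs x)) ∧
      ∀ x : Xs, ∃ U : Xs.Opens, IsAffineOpen U ∧ x ∈ U ∧ ∀ g : G, (ρs g).hom ⁻¹ᵁ U = U :=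
  phaseZero_of_tameCores_kernel p hp k X' X₁ f q G ρ hfaith hreg hρ Ms hMs (hcoreK_of_commutator p Ms hA)

/-- **Single cyclic core in the commutators** (crux stmt-ResolutionOfSingularities-15640): if `m ∈ G` of order
prime to `p` generates a NORMAL subgroup and lies in `[H, H]` for every non-p-closed `H ≤ G`, then one tame move at
`Z_⟨m⟩` gives Phase 0 for every crux datum, in every dimension. (`C_ℓ ≀ C_2`, char `2`: `m = (a, a⁻¹)`.) [folklore] -/
theorem phaseZero_of_cyclicCore_commutator (p : ℕ) (hp : p.Prime) (k : Type) [Field k] [CharP k p]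
    (X' X₁ : Scheme.{0}) (f : X₁ ⟶ Spec (.of k)) (q : X' ⟶ X₁) (G : Type) [Group G] [Finite G]
    (ρ : G →* Aut X') (hfaith : Function.Injective ρ)
    [IsSeparated f] [LocallyOfFiniteType f] [QuasiCompact f] [IsIntegral X']
    (hreg : Scheme.IsRegular X') [IsFinite q] (hρ : ∀ g : G, (ρ g).hom ≫ q = q)
    (m : G) (hm1 : m ≠ 1) (hmcop : (orderOf m).Coprime p) (hmn : (Subgroup.zpowers m).Normal)
    (hA : ∀ H : Subgroup G, ¬ HasNormalSylow p H → m ∈ ⁅H, H⁆) :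
    ∃ (Xs : Scheme.{0}) (π : Xs ⟶ X') (ρs : G →* Aut Xs), IsProper π ∧ IsBirational π ∧
      IsIntegral Xs ∧ Scheme.IsRegular Xs ∧ (∀ g : G, (ρs g).hom ≫ π = π ≫ (ρ g).hom) ∧
      (∀ x : Xs, HasNormalSylow p (inertiaSubgroup ρs x)) ∧
      ∀ x : Xs, ∃ U : Xs.Opens, IsAffineOpen U ∧ x ∈ U ∧ ∀ g : G, (ρs g).hom ⁻¹ᵁ U = U := by
  refine phaseZero_of_tameCores_commutator p hp k X' X₁ f q G ρ hfaith hreg hρ [Subgroup.zpowers m]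
    (fun M hM => ?_) fun H hH => ⟨Subgroup.zpowers m, by simp, m, hA H hH, hmcop, le_rfl⟩
  rw [List.mem_singleton] at hM
  subst hM
  refine ⟨hmn, fun h => hm1 (Subgroup.zpowers_eq_bot.mp h), ?_⟩
  rwa [Nat.card_zpowers]

end Summit.ResolutionOfSingularities.ResolutionOfSingularities.Theorems.WildQuotientResolution.StandardForm

end
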